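import Summits.Ventures.LatticeQCDFlow.Scaling.GraphSchemeSpectralGap

/-!
HONEST FRAMING: exact (Metropolis-corrected) sampling algorithms for lattice gauge theory; figures
of merit are autocorrelation/cost numbers at stated couplings and volumes; no continuum-physics
claim.

# GraphSchemeDistanceProfile — THE WORST-CASE DISTANCE OF THE HOMOGENEOUS EXCHANGE SCHEME ON A SWAP LIST DECAYS AT THE EXACT RATE `ρ`, WITH EXPLICIT PREFACTORS:
# **`d(n) ≤ (h/ρ)·(1−ρ)ⁿ`** FOR EVERY `n`, **`t_mix(ε) ≤ ⌈(1/ρ)·log(h/(ρε))⌉`** AND **`(1/ρ − 1)·log(1/(2ε)) ≤ t_mix(ε)`** FOR EVERY `ε > 0` (lean-2 GEN-48, ours)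

Venture-side (OURS).  Cell `lqcd-flow` (pub-lqcd), unit `pub-lqcd-lean-2-g48`, 2026-09-01.  Chapter AI (the sizes of the Robin ground state), file 16 — parent AI10 `GraphSchemeSpectralGap`.  AH7 typed
`d(n) ≤ (1−ρ)ⁿΣc/c_min` and `t_mix(ε) ≤ ⌈(1/ρ)·log(Σc/(c_minε))⌉` for a positive solution `c ≥ c_min > 0`; with AI2's hot minimum and AI1's trace identity `Σc/c_0 = h/ρ` both become functions of `ρ`
alone, and AI10's relaxation floor bounds the same profile below at the same rate (`λ₂ = 1 − ρ`, `γ = ρ`).  So for the scheme `t·ptGraphSwap ν^{⊗} e 1 + (1−t)·prodKernel w M` (one positive law,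
exact hot sampler, idle cold kernels, `h = (1−t)w_0`, `m ≥ 1`, distinct endpoints) and any positive solution `(c, ρ)`, `ρ > 0`: (§1) `d(n) ≤ (h/ρ)(1−ρ)ⁿ`; (§2) for every `ε > 0`,
`(1/ρ − 1)·log(1/(2ε)) ≤ t_mix(ε) ≤ ⌈(1/ρ)·log(h/(ρε))⌉` (`|S| ≥ 2` for the floor) — the `ε`-dependence is logarithmic on both sides with the same slope `1/ρ` up to `1`.  No definitions.

* §1 `graphScheme_worstTvDist_le_exp`; §2 `graphScheme_mixingTime_le_eps`, `graphScheme_mixingTime_two_sided_eps`.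

Reading (no numerics implied): no cutoff statement is made (the `¼`-floor of AI4 carries `log K`, the `ε`-floor here does not); what is typed is that the exponential rate of the distance profile
IS the Robin rate on every topology, prefactor at most `h/ρ ≤ 2(K+1)·max{K²mh/t, 1}` (AI7).  Literature grade (cell rule): OWN; nothing cited; no new bib keys.
-/

noncomputable section

open Finset Function Matrix
open Literature.Probability.MarkovChains

namespace Summit.Ventures.LatticeQCDFlow.Scaling

variable {S : Type*} [Fintype S] [DecidableEq S] {K m : ℕ} (e : Fin m → Fin (K + 1) × Fin (K + 1)) {ν : S → ℝ} {M : Fin (K + 1) → S → S → ℝ} {w : Fin (K + 1) → ℝ} {t : ℝ}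
  {P : (Fin (K + 1) → S) → (Fin (K + 1) → S) → ℝ}

/-! ## §1 The profile -/

/-- **`d(n) ≤ (h/ρ)·(1−ρ)ⁿ` FROM A POSITIVE SOLUTION** (`h = (1−t)w_0`). [ours] -/
theorem graphScheme_worstTvDist_le_exp (hm : 1 ≤ m) (he : ∀ r, (e r).1 ≠ (e r).2) (hν : ∀ v, 0 < ν v) (hν1 : ∑ v, ν v = 1) (hM0 : ∀ u v, M 0 u v = ν v)
    (hidle : ∀ i : Fin K, ∀ u v, M i.succ u v = if v = u then 1 else 0) (hw0 : ∀ k, 0 ≤ w k) (hw00 : 0 < w 0) (hw1 : ∑ k, w k = 1) (ht0 : 0 < t) (ht1 : t < 1)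
    (hP : ∀ x y, P x y = t * ptGraphSwap (fun _ : Fin (K + 1) => ν) e (fun _ => Equiv.refl S) x y + (1 - t) * prodKernel w M x y)
    {c : Fin (K + 1) → ℝ} {ρ : ℝ} (hρ0 : 0 < ρ) (hc : ∀ k, 0 < c k)
    (hvertex : ∀ k : Fin (K + 1), t / m * ∑ r : Fin m, ((if k = (e r).1 then c (e r).2 - c (e r).1 else 0) + (if k = (e r).2 then c (e r).1 - c (e r).2 else 0))
      - (if k = 0 then (1 - t) * w 0 * c k else 0) = -ρ * c k) (n : ℕ) :
    worstTvDist P (tensorFun (fun _ : Fin (K + 1) => ν)) n ≤ (1 - t) * w 0 / ρ * (1 - ρ) ^ n := by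
  have hM := (homLadder_kernels hν hν1 hM0 hidle).1
  have hh0 : 0 < (1 - t) * w 0 := mul_pos (by linarith) hw00
  have hw01 : w 0 ≤ 1 := by
    calc w 0 ≤ ∑ k, w k := Finset.single_le_sum (fun k _ => hw0 k) (mem_univ 0)
      _ = 1 := hw1
  have hrho := groundState_rho_le_hot e hc ht0.le hvertex
  have hρ1 : ρ ≤ 1 := by
    have hK1 : (1 : ℝ) ≤ (K : ℝ) + 1 := by have : (0 : ℝ) ≤ K := Nat.cast_nonneg K; linarith
    have h1 : ρ ≤ ρ * ((K : ℝ) + 1) := le_mul_of_one_le_right hρ0.le hK1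
    nlinarith
  have hmin := groundState_hot_is_min e hm ht0 hρ0 hc hvertex
  have htr := groundState_trace e hvertex
  have hvertex' : ∀ k : Fin (K + 1), t / m * ∑ r : Fin m, ((if k = (e r).1 then c (e r).2 - c (e r).1 else 0) + (if k = (e r).2 then c (e r).1 - c (e r).2 else 0))
      - (if k = 0 then (1 - t) * w 0 * c 0 else 0) = -ρ * c k := by
    intro k
    have := hvertex k
    by_cases hk : k = 0
    · subst hk; exact this
    · rw [if_neg hk] at this ⊢; exact this
  have hPl : ∀ x y, P x y = t * ptGraphProposal e (fun _ => Equiv.refl S) x y + (1 - t) * w 0 * coordKernel M 0 x y + (1 - t - (1 - t) * w 0) * (if y = x then 1 else 0) :=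
    fun x y => by rw [hP, graphScheme_lazyForm e hm he hν hidle hw1]
  have h1 := graphScheme_worstTvDist_le_mode e (h := (1 - t) * w 0) hm he ht0 hh0 (by nlinarith) hν hν1 hM hM0 hPl hρ0 hρ1 (hc 0) hmin hvertex' n
  -- `Σc/c_0 = h/ρ`
  have hratio : (∑ k : Fin (K + 1), c k) / c 0 = (1 - t) * w 0 / ρ := by
    rw [div_eq_div_iff (hc 0).ne' hρ0.ne']
    calc (∑ k : Fin (K + 1), c k) * ρ = ρ * ∑ k : Fin (K + 1), c k := mul_comm _ _
      _ = (1 - t) * w 0 * c 0 := htr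
  calc worstTvDist P (tensorFun (fun _ : Fin (K + 1) => ν)) n ≤ (1 - ρ) ^ n * (∑ k : Fin (K + 1), c k) / c 0 := h1
    _ = (∑ k : Fin (K + 1), c k) / c 0 * (1 - ρ) ^ n := by ring
    _ = (1 - t) * w 0 / ρ * (1 - ρ) ^ n := by rw [hratio]

/-! ## §2 Every `ε` -/

/-- **`t_mix(ε) ≤ ⌈(1/ρ)·log(h/(ρε))⌉` FOR EVERY `ε > 0` FROM A POSITIVE SOLUTION.** [ours] -/
theorem graphScheme_mixingTime_le_eps (hm : 1 ≤ m) (he : ∀ r, (e r).1 ≠ (e r).2) (hν : ∀ v, 0 < ν v) (hν1 : ∑ v, ν v = 1) (hM0 : ∀ u v, M 0 u v = ν v)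
    (hidle : ∀ i : Fin K, ∀ u v, M i.succ u v = if v = u then 1 else 0) (hw0 : ∀ k, 0 ≤ w k) (hw00 : 0 < w 0) (hw1 : ∑ k, w k = 1) (ht0 : 0 < t) (ht1 : t < 1)
    (hP : ∀ x y, P x y = t * ptGraphSwap (fun _ : Fin (K + 1) => ν) e (fun _ => Equiv.refl S) x y + (1 - t) * prodKernel w M x y)
    {c : Fin (K + 1) → ℝ} {ρ : ℝ} (hρ0 : 0 < ρ) (hc : ∀ k, 0 < c k)
    (hvertex : ∀ k : Fin (K + 1), t / m * ∑ r : Fin m, ((if k = (e r).1 then c (e r).2 - c (e r).1 else 0) + (if k = (e r).2 then c (e r).1 - c (e r).2 else 0))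
      - (if k = 0 then (1 - t) * w 0 * c k else 0) = -ρ * c k) {ε : ℝ} (hε : 0 < ε) :
    mixingTime P (tensorFun (fun _ : Fin (K + 1) => ν)) ε ≤ ⌈1 / ρ * Real.log ((1 - t) * w 0 / (ρ * ε))⌉₊ := by
  have hM := (homLadder_kernels hν hν1 hM0 hidle).1
  have hh0 : 0 < (1 - t) * w 0 := mul_pos (by linarith) hw00
  have hw01 : w 0 ≤ 1 := by
    calc w 0 ≤ ∑ k, w k := Finset.single_le_sum (fun k _ => hw0 k) (mem_univ 0)
      _ = 1 := hw1
  have hrho := groundState_rho_le_hot e hc ht0.le hvertex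
  have hρ1 : ρ ≤ 1 := by
    have hK1 : (1 : ℝ) ≤ (K : ℝ) + 1 := by have : (0 : ℝ) ≤ K := Nat.cast_nonneg K; linarith
    have h1 : ρ ≤ ρ * ((K : ℝ) + 1) := le_mul_of_one_le_right hρ0.le hK1
    nlinarith
  have hmin := groundState_hot_is_min e hm ht0 hρ0 hc hvertex
  have htr := groundState_trace e hvertex
  have hvertex' : ∀ k : Fin (K + 1), t / m * ∑ r : Fin m, ((if k = (e r).1 then c (e r).2 - c (e r).1 else 0) + (if k = (e r).2 then c (e r).1 - c (e r).2 else 0))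
      - (if k = 0 then (1 - t) * w 0 * c 0 else 0) = -ρ * c k := by
    intro k
    have := hvertex k
    by_cases hk : k = 0
    · subst hk; exact this
    · rw [if_neg hk] at this ⊢; exact this
  have hPl : ∀ x y, P x y = t * ptGraphProposal e (fun _ => Equiv.refl S) x y + (1 - t) * w 0 * coordKernel M 0 x y + (1 - t - (1 - t) * w 0) * (if y = x then 1 else 0) :=
    fun x y => by rw [hP, graphScheme_lazyForm e hm he hν hidle hw1]
  have hceil := graphScheme_mixingTime_le_mode e (h := (1 - t) * w 0) hm he ht0 hh0 (by nlinarith) hν hν1 hM hM0 hPl hρ0 hρ1 (hc 0) hmin hvertex' hε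
  have hratio : (∑ k : Fin (K + 1), c k) / (c 0 * ε) = (1 - t) * w 0 / (ρ * ε) := by
    rw [div_eq_div_iff (mul_pos (hc 0) hε).ne' (mul_pos hρ0 hε).ne']
    calc (∑ k : Fin (K + 1), c k) * (ρ * ε) = (ρ * ∑ k : Fin (K + 1), c k) * ε := by ring
      _ = (1 - t) * w 0 * c 0 * ε := by rw [htr]
      _ = (1 - t) * w 0 * (c 0 * ε) := by ring
  rw [hratio] at hceil
  exact hceil

/-- **THE `ε`-PROFILE IS TWO-SIDED AT THE RATE `ρ`:** on a connected list (`|S| ≥ 2`) the ground state gives, for EVERY `ε > 0`,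
**`(1/ρ − 1)·log(1/(2ε)) ≤ t_mix(ε) ≤ ⌈(1/ρ)·log(h/(ρε))⌉`** and `d(n) ≤ (h/ρ)(1−ρ)ⁿ` for every `n`, where `ρ = γ(P)` and `ρ(K+1) ≤ h`. [ours] -/
theorem graphScheme_mixingTime_two_sided_eps [Nontrivial S] (hm : 1 ≤ m) (he : ∀ r, (e r).1 ≠ (e r).2)
    (hconn : ∀ A : Finset (Fin (K + 1)), A.Nonempty → A ≠ univ → ∃ r : Fin m, ((e r).1 ∈ A ∧ (e r).2 ∉ A) ∨ ((e r).2 ∈ A ∧ (e r).1 ∉ A))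
    (hν : ∀ v, 0 < ν v) (hν1 : ∑ v, ν v = 1) (hM0 : ∀ u v, M 0 u v = ν v) (hidle : ∀ i : Fin K, ∀ u v, M i.succ u v = if v = u then 1 else 0)
    (hw0 : ∀ k, 0 ≤ w k) (hw00 : 0 < w 0) (hw1 : ∑ k, w k = 1) (ht0 : 0 < t) (ht1 : t < 1)
    (hP : ∀ x y, P x y = t * ptGraphSwap (fun _ : Fin (K + 1) => ν) e (fun _ => Equiv.refl S) x y + (1 - t) * prodKernel w M x y) {ε : ℝ} (hε : 0 < ε) :
    ∃ ρ : ℝ, 0 < ρ ∧ ρ * ((K : ℝ) + 1) ≤ (1 - t) * w 0 ∧ spectralGap (tensorFun (fun _ : Fin (K + 1) => ν)) P = ρ ∧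
      (∀ n : ℕ, worstTvDist P (tensorFun (fun _ : Fin (K + 1) => ν)) n ≤ (1 - t) * w 0 / ρ * (1 - ρ) ^ n) ∧
      (1 / ρ - 1) * Real.log (1 / (2 * ε)) ≤ (mixingTime P (tensorFun (fun _ : Fin (K + 1) => ν)) ε : ℝ) ∧
      mixingTime P (tensorFun (fun _ : Fin (K + 1) => ν)) ε ≤ ⌈1 / ρ * Real.log ((1 - t) * w 0 / (ρ * ε))⌉₊ := by
  obtain ⟨ρ, c, hρ0, hrho, hcpos, _, hvertex, hgap⟩ := graphScheme_spectralGap_exists e hm he hconn hν hν1 hM0 hidle hw0 hw00 hw1 ht0 ht1 hP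
  exact ⟨ρ, hρ0, hrho, hgap, fun n => graphScheme_worstTvDist_le_exp e hm he hν hν1 hM0 hidle hw0 hw00 hw1 ht0 ht1 hP hρ0 hcpos hvertex n,
    graphScheme_mixingTime_ge_relax e hm he hν hν1 hM0 hidle hw0 hw00 hw1 ht0 ht1 hP hρ0 hcpos hvertex hε,
    graphScheme_mixingTime_le_eps e hm he hν hν1 hM0 hidle hw0 hw00 hw1 ht0 ht1 hP hρ0 hcpos hvertex hε⟩

end Summit.Ventures.LatticeQCDFlow.Scaling

end
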